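import Summits.QuantumFields.BalabanUV.Beta.EriceRemainderEnclosureHistoryAutonomyOrderMarkov
import Summits.QuantumFields.BalabanUV.Beta.EriceRemainderEnclosureHistoryAutonomyMarkovInjective

/-!
# EriceRemainderEnclosureHistoryAutonomyComparisonCriterion — (E49i) THE EXACT CRITERION FOR COMPARISON IN THE FUNCTIONAL: for two functionals `B`, `B′` in ANY
# uniqueness regimes (zeroth moments, floors `b, b′ > 0` on ]0,γ], at most one box solution per pin — no sign of the memory assumed) with solution families
# `S`, `S′`, the box solutions of `B′` lie below those of `B` FROM EVERY PIN (`S′ x ≤ S x` for all `x ∈ ]0,γ]`, all scales) IF AND ONLY IF the EFFECTIVE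
# β-FUNCTIONS of (E48b) are ordered, `B (S y) ≤ B′ (S′ y)` for every `y ∈ ]0,γ]` of level `1∕y² − B(S y) ≥ 1∕γ²` (the reachable range of `B`'s one-step map):
# comparison is a ONE-STEP (Markov) property of the effective β-functions — which is where the sign conditions of (E49a)∕(E49c) (antitone memory) and the
# failure of (E49b) (isotone memory, back-loaded excess: `Φ_{B′} < Φ_B` at the large pins) both live

Cell `pub-balaban`, β-function sub-cell, BINDER row D4 «RemainderConst leaves for Bałaban's split» (`HOME/BINDER-OWNERS.md`; owner lineage `b2b-balaban-beta-an4`;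
this file by co-owner #2 lineage `b2b-balaban-beta-d4-p2`, generation 46), β-FLOW TEAM duty (1), FREEZE (0) honoured (def-free; (E48a)'s `family_zero` ∕
`family_succ_eq` ∕ `family_mem` ∕ `strictMonoOn_oneStep`, (E48b)'s `effective_scale_eq` ∕ `image_oneStep` ∕ `strictAntiOn_effective_scale`, (E48h)'s
`splice_seqBox`, node U2's `MemFlow` ∕ `SeqBox` BY NAME, nothing restated).  Companion of (E49a)–(E49h); the criterion is the form in which the successor's question «isotone memory + isotone excess
⟹ comparison?» ((E50a), `HOME/b2b-balaban-beta-d4-p2/g46/E50a-DOSSIER.md`) is posed.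

HONEST FRAMING (page 1, verbatim and binding).  *"Discharging BetaPertH makes Bałaban's UV stability UNCONDITIONAL — a real constructive-QFT result; it is
NOT the continuum limit and NOT the Clay problem."*  THIS FILE DISCHARGES NOTHING OF THE KIND.  Pure real analysis about ABSTRACT functionals with displayed
zeroth moments and floors and AT MOST ONE box solution per pin — hypotheses, not facts; nothing of Bałaban's (1.22) asserted (GAPS G-t4-U2-1∕-2).  Row D4
class UNCHANGED (critical-path width 0; instance 0∕1; D4 DISCHARGE NO DATE).  HONEST DEPENDENCY: continuum YM on T⁴ ⇐ BetaPertH ∧ nine spine estimates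
(0/9 proved); BetaPertH ⇐ (D1) ∧ (D4) ∧ CAP+tail; G-an2-4 gates asym, D1 and NE2/3/4.

THE POINT (census sense (α)).  By (E48a)∕(E48b) a uniquely solvable flow with memory, read on its solutions, is the one-dimensional recursion `h_{j+1} = f(h_j)`
with `f = (p ↦ S p 1)` strictly increasing, range ]0, S γ 1], and `ψ(f(p)) = 1∕p²` for the STRICTLY DECREASING effective scale function `ψ(a) = 1∕a² −
B(S a)` on that range.  So `S′ ≤ S` from every pin ⟺ `f′ ≤ f` on ]0,γ] (§2: ⟸ by induction with `f′` increasing; ⟹ at scale 1) ⟺ `ψ ≥ ψ′` i.e.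
`B(S y) ≤ B′(S′ y)` on the reachable range (§3: a level `ψ(y) ≥ 1∕γ²` makes `y` reachable — splice the solution from `y` behind the pin `(ψ y)^{-1∕2}` — and
on the range `ψ` is injective and decreasing).  Consequences: comparison in the functional is EQUIVALENT to the pointwise order of two real functions of
one variable; (E49a)∕(E49c) say antitone memory forces that order for every non-negative excess, (E49b) exhibits `Φ_{B′}(y) < Φ_B(y)` at the pins
`y ≥ h′₁` for isotone memory with a back-loaded excess.  NOT claimed: any sufficient condition beyond those files.

WHAT IS PROVED ([folklore]; 0 `def`, 0 sorry).  §1 **`splice_memFlow'`** (general memory; the box part is (E48h) `splice_seqBox` BY NAME), **`mem_range_of_level_ge`** (`ψ(y) ≥ 1∕γ² ⟹ y ∈ ]0, S γ 1]`),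
`level_ge_of_mem_range`.  §2 **`family_le_of_oneStep_le`** (`f′ ≤ f ⟹ S′ x ≤ S x` at every scale, every pin), `oneStep_le_of_family_le`.  §3
**`oneStep_le_of_effective_le`** (`Φ_B ≤ Φ_{B′}` on `B`'s reachable range ⟹ `f′ ≤ f`), **`effective_le_of_oneStep_le`** (converse), **`family_le_iff_effective_le`**
(THE CRITERION).
-/

noncomputable section
open Filter Topology Finset Set

namespace Summit.QuantumFields.BalabanUV.Beta.EriceRemainderEnclosureHistoryAutonomyComparisonCriterion

open Literature.MathematicalPhysics.QuantumFieldTheory.Balaban1983to89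
open Literature.MathematicalPhysics.QuantumFieldTheory.Balaban1983to89.T4BetaStationary
open Literature.MathematicalPhysics.QuantumFieldTheory.Balaban1983to89.T4BetaFlowWellPosed
open Summit.QuantumFields.BalabanUV.Beta.EriceRemainderEnclosureHistoryAutonomyOrder
open Summit.QuantumFields.BalabanUV.Beta.EriceRemainderEnclosureHistoryAutonomyOrderMarkov
open Summit.QuantumFields.BalabanUV.Beta.EriceRemainderEnclosureHistoryAutonomyMarkovInjective (splice_seqBox)

variable {B B' : (ℕ → ℝ) → ℝ} {M M' γ b b' : ℝ} {S S' : ℝ → ℕ → ℝ}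

/-! ## §1 Splicing behind a pin; the reachable range is a level set -/

/-- **SPLICING A SOLUTION BEHIND A PIN** (general memory): if `u` solves the flow of `B` from `y` and `1∕y² = 1∕x² + B u`, then `(x, u 0, u 1, …)` solves the
flow of `B` from `x`. [folklore] -/
theorem splice_memFlow' {x y : ℝ} {u : ℕ → ℝ} (hu : MemFlow B y u) (h0 : 1 / y ^ 2 = 1 / x ^ 2 + B u) :
    MemFlow B x (fun j => if j = 0 then x else u (j - 1)) := by
  have hvs : ∀ j : ℕ, (fun j => if j = 0 then x else u (j - 1)) (j + 1) = u j := fun j => by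
    simp only [Nat.add_one_ne_zero, if_false, Nat.add_sub_cancel]
  refine ⟨by simp, fun m => ?_⟩
  cases m with
  | zero =>
    have e1 : (fun j => (fun j => if j = 0 then x else u (j - 1)) (0 + 1 + j)) = u :=
      funext fun j => by rw [zero_add, Nat.add_comm 1 j]; exact hvs j
    rw [e1, show (0 : ℕ) + 1 = 1 from rfl, hvs 0, hu.1]
    simpa using h0
  | succ m =>
    have e1 : (fun j => (fun j => if j = 0 then x else u (j - 1)) (m + 1 + 1 + j)) = fun j => u (m + 1 + j) :=
      funext fun j => by rw [show m + 1 + 1 + j = (m + 1 + j) + 1 by omega]; exact hvs _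
    rw [e1, hvs (m + 1), hvs m]
    exact hu.2 m

/-- **A LEVEL `ψ(y) = 1∕y² − B(S y) ≥ 1∕γ²` MAKES `y` REACHABLE**: `y = S x 1` for the pin `x = (ψ y)^{-1∕2} ∈ [y, γ]`, hence `y ∈ ]0, S γ 1]` (uniqueness: the
splice IS `S x`; (E48b) `image_oneStep`). [folklore] -/
theorem mem_range_of_level_ge (hb : 0 < b) (hγ : 0 < γ)
    (hB : ∀ u u' : ℕ → ℝ, SeqBox γ u → SeqBox γ u' → ∀ D : ℝ, (∀ j, |u j - u' j| ≤ D) → |B u - B u'| ≤ M * D)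
    (hM : 0 ≤ M) (hlo : ∀ u, SeqBox γ u → b ≤ B u)
    (hS : ∀ p, 0 < p → p ≤ γ → SeqBox γ (S p) ∧ MemFlow B p (S p))
    (huniq : ∀ p, 0 < p → p ≤ γ → ∀ u u' : ℕ → ℝ, SeqBox γ u → SeqBox γ u' → MemFlow B p u → MemFlow B p u' → u = u')
    {y : ℝ} (hy : y ∈ Ioc 0 γ) (hlev : 1 / γ ^ 2 ≤ 1 / y ^ 2 - B (S y)) : y ∈ Ioc 0 (S γ 1) := by
  set L : ℝ := 1 / y ^ 2 - B (S y) with hL_def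
  have hL : 0 < L := lt_of_lt_of_le (by positivity) hlev
  set x : ℝ := 1 / Real.sqrt L with hx_def
  have hx0 : 0 < x := one_div_pos.mpr (Real.sqrt_pos.mpr hL)
  have hxsq : 1 / x ^ 2 = L := one_div_sq_one_div_sqrt hL
  have hxγ : x ≤ γ := one_div_sqrt_le hγ hlev
  -- the splice is THE solution from `x`
  have hfl : MemFlow B x (fun j => if j = 0 then x else S y (j - 1)) :=
    splice_memFlow' (hS y hy.1 hy.2).2 (by rw [hxsq, hL_def]; ring)
  have hbox := splice_seqBox hx0 hxγ (hS y hy.1 hy.2).1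
  have heq := huniq x hx0 hxγ _ _ hbox (hS x hx0 hxγ).1 hfl (hS x hx0 hxγ).2
  have hy1 : S x 1 = y := by
    have := congrFun heq 1
    simp only [one_ne_zero, if_false, Nat.sub_self] at this
    rw [← this]; exact (hS y hy.1 hy.2).2.1
  rw [← image_oneStep hb hγ hB hM hlo hS huniq]
  exact ⟨x, ⟨hx0, hxγ⟩, hy1⟩

/-- Conversely every reachable `y = S x 1` has level `ψ(y) = 1∕x² ≥ 1∕γ²` ((E48b) `effective_scale_eq`). [folklore] -/
theorem level_ge_of_mem_range (hb : 0 < b) (hγ : 0 < γ)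
    (hB : ∀ u u' : ℕ → ℝ, SeqBox γ u → SeqBox γ u' → ∀ D : ℝ, (∀ j, |u j - u' j| ≤ D) → |B u - B u'| ≤ M * D)
    (hM : 0 ≤ M) (hlo : ∀ u, SeqBox γ u → b ≤ B u)
    (hS : ∀ p, 0 < p → p ≤ γ → SeqBox γ (S p) ∧ MemFlow B p (S p))
    (huniq : ∀ p, 0 < p → p ≤ γ → ∀ u u' : ℕ → ℝ, SeqBox γ u → SeqBox γ u' → MemFlow B p u → MemFlow B p u' → u = u')
    {y : ℝ} (hy : y ∈ Ioc 0 (S γ 1)) : 1 / γ ^ 2 ≤ 1 / y ^ 2 - B (S y) := by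
  rw [← image_oneStep hb hγ hB hM hlo hS huniq] at hy
  obtain ⟨x, hx, rfl⟩ := hy
  rw [effective_scale_eq hS huniq hx]
  exact one_div_le_one_div_of_le (pow_pos hx.1 2) (pow_le_pow_left₀ hx.1.le hx.2 2)

/-! ## §2 Comparison from every pin ⟺ the one-step maps are ordered -/

/-- **ORDERED ONE-STEP MAPS ⟹ ORDERED FAMILIES**: `S′ a 1 ≤ S a 1` for all `a ∈ ]0,γ]` ⟹ `S′ x j ≤ S x j` for every pin and every scale (induction, with
(E48a) `strictMonoOn_oneStep` for `B′`). [folklore] -/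
theorem family_le_of_oneStep_le (hb' : 0 < b') (hγ : 0 < γ)
    (hB' : ∀ u u' : ℕ → ℝ, SeqBox γ u → SeqBox γ u' → ∀ D : ℝ, (∀ j, |u j - u' j| ≤ D) → |B' u - B' u'| ≤ M' * D)
    (hM' : 0 ≤ M') (hlo' : ∀ u, SeqBox γ u → b' ≤ B' u)
    (hS : ∀ p, 0 < p → p ≤ γ → SeqBox γ (S p) ∧ MemFlow B p (S p))
    (huniq : ∀ p, 0 < p → p ≤ γ → ∀ u u' : ℕ → ℝ, SeqBox γ u → SeqBox γ u' → MemFlow B p u → MemFlow B p u' → u = u')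
    (hS' : ∀ p, 0 < p → p ≤ γ → SeqBox γ (S' p) ∧ MemFlow B' p (S' p))
    (huniq' : ∀ p, 0 < p → p ≤ γ → ∀ u u' : ℕ → ℝ, SeqBox γ u → SeqBox γ u' → MemFlow B' p u → MemFlow B' p u' → u = u')
    (hstep : ∀ a, 0 < a → a ≤ γ → S' a 1 ≤ S a 1) {x : ℝ} (hx : x ∈ Ioc 0 γ) : ∀ j, S' x j ≤ S x j
  | 0 => by rw [family_zero hS hx.1 hx.2, family_zero hS' hx.1 hx.2]
  | j + 1 => by
    have ih := family_le_of_oneStep_le hb' hγ hB' hM' hlo' hS huniq hS' huniq' hstep hx j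
    have hm := family_mem hS hx.1 hx.2 j
    have hm' := family_mem hS' hx.1 hx.2 j
    rw [family_succ_eq hS huniq hx.1 hx.2 j, family_succ_eq hS' huniq' hx.1 hx.2 j]
    calc S' (S' x j) 1 ≤ S' (S x j) 1 := (strictMonoOn_oneStep hb' hγ hB' hM' hlo' hS' huniq').monotoneOn hm' hm ih
      _ ≤ S (S x j) 1 := hstep _ hm.1 hm.2

/-- Conversely ordered families give ordered one-step maps (scale 1). [folklore] -/
theorem oneStep_le_of_family_le (hle : ∀ x, 0 < x → x ≤ γ → ∀ j, S' x j ≤ S x j) : ∀ a, 0 < a → a ≤ γ → S' a 1 ≤ S a 1 :=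
  fun a ha haγ => hle a ha haγ 1

/-! ## §3 Ordered one-step maps ⟺ ordered effective β-functions on the reachable range -/

/-- **ORDERED EFFECTIVE β-FUNCTIONS ⟹ ORDERED ONE-STEP MAPS.**  If `B (S y) ≤ B′ (S′ y)` for every `y ∈ ]0,γ]` reachable by `B` (`y ∈ ]0, S γ 1]`), then
`S′ a 1 ≤ S a 1` for all pins `a`: if `y′ = S′ a 1 ≤ S γ 1` (reachable for `B`) then `ψ(y′) ≥ ψ′(y′) = 1∕a² = ψ(S a 1)` and `ψ` is strictly decreasing
on the range; `y′ > S γ 1` is impossible (it would give `S γ 1 < S′ γ 1` and, at the reachable point `S γ 1`, `ψ′(S γ 1) ≤ 1∕γ² = ψ′(S′ γ 1)` against the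
strict decrease of `ψ′`). [folklore] -/
theorem oneStep_le_of_effective_le (hb : 0 < b) (hb' : 0 < b') (hγ : 0 < γ)
    (hB : ∀ u u' : ℕ → ℝ, SeqBox γ u → SeqBox γ u' → ∀ D : ℝ, (∀ j, |u j - u' j| ≤ D) → |B u - B u'| ≤ M * D)
    (hM : 0 ≤ M) (hlo : ∀ u, SeqBox γ u → b ≤ B u)
    (hB' : ∀ u u' : ℕ → ℝ, SeqBox γ u → SeqBox γ u' → ∀ D : ℝ, (∀ j, |u j - u' j| ≤ D) → |B' u - B' u'| ≤ M' * D)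
    (hM' : 0 ≤ M') (hlo' : ∀ u, SeqBox γ u → b' ≤ B' u)
    (hS : ∀ p, 0 < p → p ≤ γ → SeqBox γ (S p) ∧ MemFlow B p (S p))
    (huniq : ∀ p, 0 < p → p ≤ γ → ∀ u u' : ℕ → ℝ, SeqBox γ u → SeqBox γ u' → MemFlow B p u → MemFlow B p u' → u = u')
    (hS' : ∀ p, 0 < p → p ≤ γ → SeqBox γ (S' p) ∧ MemFlow B' p (S' p))
    (huniq' : ∀ p, 0 < p → p ≤ γ → ∀ u u' : ℕ → ℝ, SeqBox γ u → SeqBox γ u' → MemFlow B' p u → MemFlow B' p u' → u = u')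
    (heff : ∀ y, y ∈ Ioc 0 (S γ 1) → B (S y) ≤ B' (S' y)) : ∀ a, 0 < a → a ≤ γ → S' a 1 ≤ S a 1 := by
  intro a ha haγ
  have ha' : a ∈ Ioc (0 : ℝ) γ := ⟨ha, haγ⟩
  have hy' : S' a 1 ∈ Ioc (0 : ℝ) γ := family_mem hS' ha haγ 1
  have hreach : ∀ c, 0 < c → c ≤ γ → S' c 1 ∈ Ioc 0 (S γ 1) → S' c 1 ≤ S c 1 := by
    intro c hc hcγ hr
    have hc' : c ∈ Ioc (0 : ℝ) γ := ⟨hc, hcγ⟩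
    have ec' := effective_scale_eq hS' huniq' hc'
    have ec := effective_scale_eq hS huniq hc'
    have h1 : 1 / (S c 1) ^ 2 - B (S (S c 1)) ≤ 1 / (S' c 1) ^ 2 - B (S (S' c 1)) := by
      rw [ec]; linarith [heff _ hr, ec']
    -- ψ strictly decreasing on the range, both points in the range
    have hSc : S c 1 ∈ Ioc 0 (S γ 1) := by
      rw [← image_oneStep hb hγ hB hM hlo hS huniq]; exact ⟨c, hc', rfl⟩
    refine le_of_not_gt fun hlt => ?_
    have := strictAntiOn_effective_scale hb hγ hB hM hlo hS huniq
      (show S c 1 ∈ (fun p => S p 1) '' Ioc 0 γ from ⟨c, hc', rfl⟩)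
      (show S' c 1 ∈ (fun p => S p 1) '' Ioc 0 γ by rw [image_oneStep hb hγ hB hM hlo hS huniq]; exact hr) hlt
    linarith
  rcases le_or_gt (S' a 1) (S γ 1) with hle | hgt
  · exact hreach a ha haγ ⟨hy'.1, hle⟩
  · -- `S′ a 1 > S γ 1` is impossible: then `S γ 1 < S′ γ 1`, and at the `B`-reachable point `S γ 1` the hypothesis gives `ψ′(S γ 1) ≤ ψ(S γ 1) = 1∕γ² = ψ′(S′ γ 1)`,
    -- against the strict decrease of `ψ′` on `B′`'s range
    exfalso
    have hmono' := (strictMonoOn_oneStep hb' hγ hB' hM' hlo' hS' huniq').monotoneOn ha' ⟨hγ, le_rfl⟩ haγ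
    have hgt' : S γ 1 < S' γ 1 := hgt.trans_le hmono'
    have hγ' : γ ∈ Ioc (0 : ℝ) γ := ⟨hγ, le_rfl⟩
    have eγ' := effective_scale_eq hS' huniq' hγ'
    have eγ := effective_scale_eq hS huniq hγ'
    -- the point S γ 1 is reachable for B; heff there: B (S (S γ 1)) ≤ B′ (S′ (S γ 1)); so ψ′(S γ 1) ≤ ψ(S γ 1) = 1/γ² = ψ′(S′ γ 1)
    have hr : S γ 1 ∈ Ioc 0 (S γ 1) := ⟨(family_mem hS hγ le_rfl 1).1, le_rfl⟩
    have h1 : 1 / (S γ 1) ^ 2 - B' (S' (S γ 1)) ≤ 1 / (S' γ 1) ^ 2 - B' (S' (S' γ 1)) := by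
      rw [eγ']; linarith [heff _ hr, eγ]
    -- ψ′ strictly decreasing on B′'s range ]0, S′ γ 1], and S γ 1 < S′ γ 1 both in it ⟹ ψ′(S γ 1) > ψ′(S′ γ 1): contradiction
    have hin1 : S γ 1 ∈ (fun p => S' p 1) '' Ioc 0 γ := by
      rw [image_oneStep hb' hγ hB' hM' hlo' hS' huniq']; exact ⟨hr.1, hgt'.le⟩
    have hin2 : S' γ 1 ∈ (fun p => S' p 1) '' Ioc 0 γ := ⟨γ, hγ', rfl⟩
    have := strictAntiOn_effective_scale hb' hγ hB' hM' hlo' hS' huniq' hin1 hin2 hgt'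
    linarith

/-- **ORDERED ONE-STEP MAPS ⟹ ORDERED EFFECTIVE β-FUNCTIONS on `B`'s reachable range**: `S′ ≤ S` at scale 1 from every pin ⟹ `B (S y) ≤ B′ (S′ y)` for every
`y ∈ ]0, S γ 1]` (write `y = S x 1`; then `ψ′(S′ x 1) = 1∕x² = ψ(y)` and `S′ x 1 ≤ y` with `ψ′` decreasing on its range gives `ψ′(y) ≤ ψ(y)`). [folklore] -/
theorem effective_le_of_oneStep_le (hb : 0 < b) (hb' : 0 < b') (hγ : 0 < γ)
    (hB : ∀ u u' : ℕ → ℝ, SeqBox γ u → SeqBox γ u' → ∀ D : ℝ, (∀ j, |u j - u' j| ≤ D) → |B u - B u'| ≤ M * D)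
    (hM : 0 ≤ M) (hlo : ∀ u, SeqBox γ u → b ≤ B u)
    (hB' : ∀ u u' : ℕ → ℝ, SeqBox γ u → SeqBox γ u' → ∀ D : ℝ, (∀ j, |u j - u' j| ≤ D) → |B' u - B' u'| ≤ M' * D)
    (hM' : 0 ≤ M') (hlo' : ∀ u, SeqBox γ u → b' ≤ B' u)
    (hS : ∀ p, 0 < p → p ≤ γ → SeqBox γ (S p) ∧ MemFlow B p (S p))
    (huniq : ∀ p, 0 < p → p ≤ γ → ∀ u u' : ℕ → ℝ, SeqBox γ u → SeqBox γ u' → MemFlow B p u → MemFlow B p u' → u = u')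
    (hS' : ∀ p, 0 < p → p ≤ γ → SeqBox γ (S' p) ∧ MemFlow B' p (S' p))
    (huniq' : ∀ p, 0 < p → p ≤ γ → ∀ u u' : ℕ → ℝ, SeqBox γ u → SeqBox γ u' → MemFlow B' p u → MemFlow B' p u' → u = u')
    (hstep : ∀ a, 0 < a → a ≤ γ → S' a 1 ≤ S a 1) {y : ℝ} (hy : y ∈ Ioc 0 (S γ 1)) : B (S y) ≤ B' (S' y) := by
  have hy' := hy
  rw [← image_oneStep hb hγ hB hM hlo hS huniq] at hy'
  obtain ⟨x, hx, rfl⟩ := hy'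
  have e := effective_scale_eq hS huniq hx
  have e' := effective_scale_eq hS' huniq' hx
  have hle : S' x 1 ≤ S x 1 := hstep x hx.1 hx.2
  -- ψ′(S x 1) ≤ ψ′(S′ x 1) = 1/x² = ψ(S x 1), IF S x 1 lies in B′'s range; if not (S x 1 > S′ γ 1) use the pin γ as in the previous proof
  rcases le_or_gt (S x 1) (S' γ 1) with hin | hout
  · have hm1 : S' x 1 ∈ (fun p => S' p 1) '' Ioc 0 γ := ⟨x, hx, rfl⟩
    have hm2 : S x 1 ∈ (fun p => S' p 1) '' Ioc 0 γ := by
      rw [image_oneStep hb' hγ hB' hM' hlo' hS' huniq']; exact ⟨(family_mem hS hx.1 hx.2 1).1, hin⟩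
    have hψ' : 1 / (S x 1) ^ 2 - B' (S' (S x 1)) ≤ 1 / (S' x 1) ^ 2 - B' (S' (S' x 1)) :=
      (strictAntiOn_effective_scale hb' hγ hB' hM' hlo' hS' huniq').antitoneOn hm1 hm2 hle
    linarith
  · -- S x 1 > S′ γ 1 ≥ S′ x 1; the B′-level of S x 1 is then < 1/γ² (not reachable for B′), i.e. 1/(S x 1)² − B′(S′(S x 1)) < 1/γ² ≤ 1/x² = ψ(S x 1)
    have hnot : ¬ (1 / γ ^ 2 ≤ 1 / (S x 1) ^ 2 - B' (S' (S x 1))) := by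
      intro hlev
      have := mem_range_of_level_ge hb' hγ hB' hM' hlo' hS' huniq' (family_mem hS hx.1 hx.2 1) hlev
      exact absurd this.2 (not_le.mpr hout)
    have hlevx : 1 / γ ^ 2 ≤ 1 / x ^ 2 := one_div_le_one_div_of_le (pow_pos hx.1 2) (pow_le_pow_left₀ hx.1.le hx.2 2)
    have hnot' := not_le.mp hnot
    linarith

/-- **THE CRITERION.**  Two functionals `B`, `B′` with zeroth moments, floors `b, b′ > 0` on ]0,γ] and solution families `S`, `S′` (one box solution from every
pin, unique).  Then: the box solution of `B′` lies below that of `B` at EVERY scale FROM EVERY PIN  ⟺  `B (S y) ≤ B′ (S′ y)` for every `y ∈ ]0, S γ 1]` —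
the effective β-functions are ordered on `B`'s reachable range.  No sign of the memory is assumed. [folklore] -/
theorem family_le_iff_effective_le (hb : 0 < b) (hb' : 0 < b') (hγ : 0 < γ)
    (hB : ∀ u u' : ℕ → ℝ, SeqBox γ u → SeqBox γ u' → ∀ D : ℝ, (∀ j, |u j - u' j| ≤ D) → |B u - B u'| ≤ M * D)
    (hM : 0 ≤ M) (hlo : ∀ u, SeqBox γ u → b ≤ B u)
    (hB' : ∀ u u' : ℕ → ℝ, SeqBox γ u → SeqBox γ u' → ∀ D : ℝ, (∀ j, |u j - u' j| ≤ D) → |B' u - B' u'| ≤ M' * D)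
    (hM' : 0 ≤ M') (hlo' : ∀ u, SeqBox γ u → b' ≤ B' u)
    (hS : ∀ p, 0 < p → p ≤ γ → SeqBox γ (S p) ∧ MemFlow B p (S p))
    (huniq : ∀ p, 0 < p → p ≤ γ → ∀ u u' : ℕ → ℝ, SeqBox γ u → SeqBox γ u' → MemFlow B p u → MemFlow B p u' → u = u')
    (hS' : ∀ p, 0 < p → p ≤ γ → SeqBox γ (S' p) ∧ MemFlow B' p (S' p))
    (huniq' : ∀ p, 0 < p → p ≤ γ → ∀ u u' : ℕ → ℝ, SeqBox γ u → SeqBox γ u' → MemFlow B' p u → MemFlow B' p u' → u = u') :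
    (∀ x, 0 < x → x ≤ γ → ∀ j, S' x j ≤ S x j) ↔ ∀ y, y ∈ Ioc 0 (S γ 1) → B (S y) ≤ B' (S' y) :=
  ⟨fun hle _ hy => effective_le_of_oneStep_le hb hb' hγ hB hM hlo hB' hM' hlo' hS huniq hS' huniq' (oneStep_le_of_family_le hle) hy,
    fun heff _ hx hxγ => family_le_of_oneStep_le hb' hγ hB' hM' hlo' hS huniq hS' huniq'
      (oneStep_le_of_effective_le hb hb' hγ hB hM hlo hB' hM' hlo' hS huniq hS' huniq' heff) ⟨hx, hxγ⟩⟩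

end Summit.QuantumFields.BalabanUV.Beta.EriceRemainderEnclosureHistoryAutonomyComparisonCriterion

end
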